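import Summits.QuantumFields.BalabanUV.Beta.GAN24.CombChargeAntisymPairForm

/-!
# `BalabanUV.Beta.GAN24.PairFormPeriodTower` — binder row G-an2-4 ∕ (CONV-C), W-slot (α-0), ROW (C) AT LEVELS `≥ 1`, the OWNER's JUNCTION for leaf-02 g68's
# «UNROLL THE TOWER IN THE FACE PERIOD» (memo `CT-THREE-CHANNELS-g68.md` §4; RULING R-gan24p1-g40-1):
# **THE ANTISYMMETRIC-PAIR FORM PROPAGATES UP A TWO-INDEX TOWER** — amplitudes `Z m i` indexed by a PERIOD index `m` and a LEVEL `i`; if every base amplitude `Z m 0` has the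
# pair form and every step reads `LS(Z m (i+1)) = (pair form) + c·LS(Z (σ m) i)` (the level-`i+1` member on period-`m` face fields = its own pair-form words + a multiple of the
# level-`i` member on the LONGER period `σ m`), then EVERY `Z m i` has the pair form (induction on the level with the period generalised — the device of leaf-06 g50's
# `SourcePairingTowerClosed.sourcePairing_tower_closed`, «all of `P` generalised») (G-an2-4 OWNER `b2b-balaban-gan24-p1`, gen 40; journal [GAN24P1-G40-INTENT1])

NOT IN PRINT; OUR BOOKKEEPING ([folklore] finite index algebra, one induction; 0 `def`, 0 cited fact, 0 `def … : Prop`, 0 sorry).  HONEST FRAMING (cell contract, verbatim):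
«discharging `BetaPertH` makes Bałaban's UV stability UNCONDITIONAL — a real constructive-QFT result; it is NOT the continuum limit and NOT the Clay problem.»  HONEST DEPENDENCY
(verbatim): «continuum YM on T⁴ ⇐ BetaPertH ∧ nine spine estimates (0/9 proved); BetaPertH ⇐ (D1) ∧ (D4) ∧ CAP+tail; G-an2-4 gates asym, D1 and NE2/3/4.»

WHY.  Road-P2 g49's END SOCKET (`CombChargePairFormTower.rowCLegSymEven_of_sourcePairForm_crossed`) asks, per level, that the leg-and-bond symmetrised zero-mode charge `LS` of the
B-frame SOURCE be a PAIR FORM (`hSrc`: `LS(κ,κ′;κ₁,κ₂) = S(κκ₁;κ′κ₂) + S(κ′κ₁;κκ₂) + S(κκ₂;κ′κ₁) + S(κ′κ₂;κκ₁)`, `S` antisymmetric in each of its two pairs) with vanishing crossed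
orbit sums (`hSrcX`).  By leaf-02 g67∕g68 (P38 ∕ P39 ∕ P40 ∕ P41 + memo §§1–3) the level-`j+1` member's `LS`-ed zero mode is `c_j·(|box|·LS(PAIRFORM_j) − ½·|box|·cH_j²·LS(FOURFACE_j))`
(the response words die in `LS`), and `FOURFACE_j` contains, besides the level-`j` zero mode, the DRESSING-DEFECT zero modes `zmode(𝔇T̃_j − T̃_j)` — road-P2 g49's located (G14),
NO HOLDER — which are the SAME amplitude one level down READ ON PERIOD-`Lc²` FACE FIELDS (memo §4).  So the recursion does not close on the period-`Lc` zero modes: the state at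
level `i` is the whole family `m ↦ Z m i` of face-period reads, `Z m (i+1) = PF^{(m)}_i + c·Z (m+1) i` after `LS`.  RULING R-gan24p1-g40-1 (OWNER): (G14) ∕ leaf-02's (β) is
NOT a standalone face identity of the member (that would be «T2Shape», which the (α-0) chain DERIVES from (C)); it is proved by the period-generalised induction below, whose
per-step inputs are the suppliers' natural currency — a pair form per WORD and PERIOD (contact words: bond–leg antisymmetry of the period-`Lc^m` face currents + the cell transfer,
leaf-06 ∕ leaf-02; base: the level-`0` Wilson table read on period-`Lc^m` faces, a closed form) — and whose output at the period index of the CONSTANT read (road-P2's `zmode`; `m = 0` in §4's `hZ0` convention, `Φ_1` in leaf-02's numbering) is road-P2's member ∕ source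
pair form at every level.
WHAT (generic index type `ι`; «`LS_A`» := `A κκ′κ₁κ₂ + A κ′κκ₁κ₂ + (A κκ′κ₂κ₁ + A κ′κκ₂κ₁)`; «pair form of `R`» := `R κκ₁κ′κ₂ + R κ′κ₁κκ₂ + (R κκ₂κ′κ₁ + R κ′κ₂κκ₁)` with `R`
antisymmetric in each pair — `CombChargeAntisymPairForm`'s spelling VERBATIM, no `def`):
* §1 closure of «`LS_A` is a pair form» under scalars, sums, differences and under a step display `LS_A = (pair form) + t·LS_B` (`antisym_smul_fst ∕ _snd`,
  `exists_pairFormLS_smul ∕ _add ∕ _sub`, **`exists_pairFormLS_of_step`**);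
* §2 **`pairFormLS_tower₂_reindex`** — the two-index tower over an ARBITRARY period-index type `π` with any re-indexing `σ : π → π` in the lower term; **`pairFormLS_tower₂`** — `σ m = m + 1`
  (leaf-02 §4's `Φ_m(i+1) = PF^{(m)}_i + c_i·Φ_{m+1}(i)`); **`pairFormLS_tower₂_diff`** — the SOURCE-type difference `LS(Z m (i+1)) − u·LS(Z m i)` is then a pair form at every
  `(m, i)` (road-P2's `hSrc` shape at the constant-read index, charge factor `u = 1` at the pins by `T2RecChargeLedger.charge_factor_eq_one_of_pinEq`).
* §3 the crossed-VALUE ledger (scalars only, NO value asserted): **`crossed_of_step`** — the `(a,b;a,b)` entry of a step display is `−2·T(ab;ab) + t·(lower crossed sum)`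
  (one scalar per pair, level and period); **`crossed_tower₂_const`** ∕ **`crossed_tower₂_diff`** — the located SUFFICIENT condition for `hSrcX`: level-independent word values
  `p m` and coefficients `c m` with the one base identity `p m + c m·w (m+1) = w m` per period make the crossed value conserved along the tower at every period; **`crossed_tower₂_eq_of_candidate`** — the general (level-dependent) ledger is guess-and-verify:
  a candidate closed form with the same base and step recursion IS the crossed value (uniqueness);
* §4 **`zsymLegSymEven_of_tower₂_crossed`** — AT THE CAPSTONE's DISPLAY (generic constants ∕ tables ∕ root): for any two-index family whose period-index-`0` row is road-P2's
  member charge `zmode Lc (unitS₂_i T̃_i)` (`hZ0`), `h0 ∧ hstep` give `hPair` at every member level, hence with `hX` the even-class row `hZeven` VERBATIM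
  (`CombChargeAntisymPairForm.zsymLegSymEven_of_pairFormLS_crossed`);
* §5 the LIST-VALUED step: **`exists_pairFormLS_finsum`** (finite weighted sums of pair forms are pair forms) and **`pairFormLS_tower₂_multi`** — the two-index tower whose
  step display carries FINITELY MANY lower-level terms `Σ_{k ∈ s} c m i k · LS(Z (σ m k) i)` (words reading the level-`i` member on several deeper periods at once, e.g. mixed
  slot ∕ leg periods).  Discharges NOTHING of (C) (every display is a hypothesis here), nor (Q-L) ∕ (H1♮) ∕ (hW, hWall); asserts NO value and NO shape of Bałaban's tables; NEVER
«G-an2-4 closed» as (CONV-C); NOT D1, NOT `BetaPertH`, NOT continuum, NOT Clay.  2026-08-24; no existing file touched.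
-/

noncomputable section

open Literature.MathematicalPhysics.QuantumFieldTheory
open Literature.MathematicalPhysics.QuantumFieldTheory.Balaban1983to89
open Literature.MathematicalPhysics.QuantumFieldTheory.Balaban1983to89.Beta
open ExpKernelCalculus (MKer)
open OneStepResolventKernel (Fib)
open AffineAveraging (Site box toSite)
open AveragingMixedJetTables (mixFFAt)
open PolarizationSign (reflSign)
open Summit.QuantumFields.BalabanUV.Beta.SecondOrderUnits (unitS₂)
open Summit.QuantumFields.BalabanUV.Beta.SpineRooted (T2RecAt)
open Summit.QuantumFields.BalabanUV.Beta.GAN24.CombesThomas (sfStep smStep)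
open Summit.QuantumFields.BalabanUV.Beta.GAN24.BiStencilZeroMode (Tab zmode)

namespace Summit.QuantumFields.BalabanUV.Beta.GAN24.PairFormPeriodTower

/-! ## §1 Closure of the antisymmetric-pair form under linear combinations and under a step display -/

section Algebra

variable {ι : Type*} {A B : ι → ι → ι → ι → ℝ} {R S T : ι → ι → ι → ι → ℝ}

/-- [folklore] A scalar multiple of a pair function antisymmetric in its FIRST pair is antisymmetric in its first pair. -/
theorem antisym_smul_fst (hR1 : ∀ a b c e, R b a c e = -R a b c e) (t : ℝ) (a b c e : ι) :
    t * R b a c e = -(t * R a b c e) := by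
  rw [hR1]; ring

/-- [folklore] A scalar multiple of a pair function antisymmetric in its SECOND pair is antisymmetric in its second pair. -/
theorem antisym_smul_snd (hR2 : ∀ a b c e, R a b e c = -R a b c e) (t : ℝ) (a b c e : ι) :
    t * R a b e c = -(t * R a b c e) := by
  rw [hR2]; ring

/-- [folklore] The difference of two pair functions antisymmetric in the first pair is antisymmetric in the first pair. -/
theorem antisym_sub_fst (hR1 : ∀ a b c e, R b a c e = -R a b c e) (hS1 : ∀ a b c e, S b a c e = -S a b c e) (a b c e : ι) :
    R b a c e - S b a c e = -(R a b c e - S a b c e) := by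
  rw [hR1, hS1]; ring

/-- [folklore] The difference of two pair functions antisymmetric in the second pair is antisymmetric in the second pair. -/
theorem antisym_sub_snd (hR2 : ∀ a b c e, R a b e c = -R a b c e) (hS2 : ∀ a b c e, S a b e c = -S a b c e) (a b c e : ι) :
    R a b e c - S a b e c = -(R a b c e - S a b c e) := by
  rw [hR2, hS2]; ring

/-- NOT IN PRINT; OUR BOOKKEEPING.  **SCALARS**: if `LS_A` is a pair form then so is `LS_{t·A}` (with `t·R`). -/
theorem exists_pairFormLS_smul
    (hA : ∃ R : ι → ι → ι → ι → ℝ, (∀ a b c e, R b a c e = -R a b c e) ∧ (∀ a b c e, R a b e c = -R a b c e) ∧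
      ∀ κ κ' κ₁ κ₂, A κ κ' κ₁ κ₂ + A κ' κ κ₁ κ₂ + (A κ κ' κ₂ κ₁ + A κ' κ κ₂ κ₁) = R κ κ₁ κ' κ₂ + R κ' κ₁ κ κ₂ + (R κ κ₂ κ' κ₁ + R κ' κ₂ κ κ₁))
    (t : ℝ) :
    ∃ R : ι → ι → ι → ι → ℝ, (∀ a b c e, R b a c e = -R a b c e) ∧ (∀ a b c e, R a b e c = -R a b c e) ∧
      ∀ κ κ' κ₁ κ₂, t * A κ κ' κ₁ κ₂ + t * A κ' κ κ₁ κ₂ + (t * A κ κ' κ₂ κ₁ + t * A κ' κ κ₂ κ₁)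
        = R κ κ₁ κ' κ₂ + R κ' κ₁ κ κ₂ + (R κ κ₂ κ' κ₁ + R κ' κ₂ κ κ₁) := by
  obtain ⟨R, hR1, hR2, hR⟩ := hA
  refine ⟨fun a b c e => t * R a b c e, antisym_smul_fst hR1 t, antisym_smul_snd hR2 t, fun κ κ' κ₁ κ₂ => ?_⟩
  have h := hR κ κ' κ₁ κ₂
  have h' : t * (A κ κ' κ₁ κ₂ + A κ' κ κ₁ κ₂ + (A κ κ' κ₂ κ₁ + A κ' κ κ₂ κ₁))
      = t * (R κ κ₁ κ' κ₂ + R κ' κ₁ κ κ₂ + (R κ κ₂ κ' κ₁ + R κ' κ₂ κ κ₁)) := by rw [h]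
  dsimp only
  linarith

/-- NOT IN PRINT; OUR BOOKKEEPING.  **SUMS** (`CombChargeAntisymPairForm.pairFormLS_add` in `∃`-packaging): if `LS_A` and `LS_B` are pair forms then so is `LS_{A+B}`. -/
theorem exists_pairFormLS_add
    (hA : ∃ R : ι → ι → ι → ι → ℝ, (∀ a b c e, R b a c e = -R a b c e) ∧ (∀ a b c e, R a b e c = -R a b c e) ∧
      ∀ κ κ' κ₁ κ₂, A κ κ' κ₁ κ₂ + A κ' κ κ₁ κ₂ + (A κ κ' κ₂ κ₁ + A κ' κ κ₂ κ₁) = R κ κ₁ κ' κ₂ + R κ' κ₁ κ κ₂ + (R κ κ₂ κ' κ₁ + R κ' κ₂ κ κ₁))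
    (hB : ∃ S : ι → ι → ι → ι → ℝ, (∀ a b c e, S b a c e = -S a b c e) ∧ (∀ a b c e, S a b e c = -S a b c e) ∧
      ∀ κ κ' κ₁ κ₂, B κ κ' κ₁ κ₂ + B κ' κ κ₁ κ₂ + (B κ κ' κ₂ κ₁ + B κ' κ κ₂ κ₁) = S κ κ₁ κ' κ₂ + S κ' κ₁ κ κ₂ + (S κ κ₂ κ' κ₁ + S κ' κ₂ κ κ₁)) :
    ∃ R : ι → ι → ι → ι → ℝ, (∀ a b c e, R b a c e = -R a b c e) ∧ (∀ a b c e, R a b e c = -R a b c e) ∧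
      ∀ κ κ' κ₁ κ₂, (A κ κ' κ₁ κ₂ + B κ κ' κ₁ κ₂) + (A κ' κ κ₁ κ₂ + B κ' κ κ₁ κ₂) + ((A κ κ' κ₂ κ₁ + B κ κ' κ₂ κ₁) + (A κ' κ κ₂ κ₁ + B κ' κ κ₂ κ₁))
        = R κ κ₁ κ' κ₂ + R κ' κ₁ κ κ₂ + (R κ κ₂ κ' κ₁ + R κ' κ₂ κ κ₁) := by
  obtain ⟨R, hR1, hR2, hR⟩ := hA
  obtain ⟨S, hS1, hS2, hS⟩ := hB
  refine ⟨fun a b c e => R a b c e + S a b c e, CombChargeAntisymPairForm.antisym_add_fst hR1 hS1,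
    CombChargeAntisymPairForm.antisym_add_snd hR2 hS2, fun κ κ' κ₁ κ₂ => ?_⟩
  have h1 := hR κ κ' κ₁ κ₂
  have h2 := hS κ κ' κ₁ κ₂
  dsimp only
  linarith

/-- NOT IN PRINT; OUR BOOKKEEPING.  **DIFFERENCES** (the SOURCE shape `member − (charge factor)·member`): if `LS_A` and `LS_B` are pair forms then so is `LS_{A − u·B}`. -/
theorem exists_pairFormLS_sub
    (hA : ∃ R : ι → ι → ι → ι → ℝ, (∀ a b c e, R b a c e = -R a b c e) ∧ (∀ a b c e, R a b e c = -R a b c e) ∧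
      ∀ κ κ' κ₁ κ₂, A κ κ' κ₁ κ₂ + A κ' κ κ₁ κ₂ + (A κ κ' κ₂ κ₁ + A κ' κ κ₂ κ₁) = R κ κ₁ κ' κ₂ + R κ' κ₁ κ κ₂ + (R κ κ₂ κ' κ₁ + R κ' κ₂ κ κ₁))
    (hB : ∃ S : ι → ι → ι → ι → ℝ, (∀ a b c e, S b a c e = -S a b c e) ∧ (∀ a b c e, S a b e c = -S a b c e) ∧
      ∀ κ κ' κ₁ κ₂, B κ κ' κ₁ κ₂ + B κ' κ κ₁ κ₂ + (B κ κ' κ₂ κ₁ + B κ' κ κ₂ κ₁) = S κ κ₁ κ' κ₂ + S κ' κ₁ κ κ₂ + (S κ κ₂ κ' κ₁ + S κ' κ₂ κ κ₁))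
    (u : ℝ) :
    ∃ R : ι → ι → ι → ι → ℝ, (∀ a b c e, R b a c e = -R a b c e) ∧ (∀ a b c e, R a b e c = -R a b c e) ∧
      ∀ κ κ' κ₁ κ₂, (A κ κ' κ₁ κ₂ - u * B κ κ' κ₁ κ₂) + (A κ' κ κ₁ κ₂ - u * B κ' κ κ₁ κ₂)
          + ((A κ κ' κ₂ κ₁ - u * B κ κ' κ₂ κ₁) + (A κ' κ κ₂ κ₁ - u * B κ' κ κ₂ κ₁))
        = R κ κ₁ κ' κ₂ + R κ' κ₁ κ κ₂ + (R κ κ₂ κ' κ₁ + R κ' κ₂ κ κ₁) := by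
  obtain ⟨R, hR1, hR2, hR⟩ := hA
  obtain ⟨S, hS1, hS2, hS⟩ := hB
  refine ⟨fun a b c e => R a b c e - u * S a b c e, antisym_sub_fst hR1 (antisym_smul_fst hS1 u),
    antisym_sub_snd hR2 (antisym_smul_snd hS2 u), fun κ κ' κ₁ κ₂ => ?_⟩
  have h1 := hR κ κ' κ₁ κ₂
  have h2 := hS κ κ' κ₁ κ₂
  have h2' : u * (B κ κ' κ₁ κ₂ + B κ' κ κ₁ κ₂ + (B κ κ' κ₂ κ₁ + B κ' κ κ₂ κ₁))
      = u * (S κ κ₁ κ' κ₂ + S κ' κ₁ κ κ₂ + (S κ κ₂ κ' κ₁ + S κ' κ₂ κ κ₁)) := by rw [h2]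
  dsimp only
  linarith

/-- NOT IN PRINT; OUR BOOKKEEPING.  **ONE STEP DISPLAY**: if `LS_A = (pair form of T) + t·LS_B` entry by entry (the level-`i+1` amplitude = its own pair-form words + a multiple
of the lower-level amplitude on the longer period) and `LS_B` is a pair form, then `LS_A` is a pair form (with `T + t·S`). -/
theorem exists_pairFormLS_of_step {t : ℝ}
    (hT1 : ∀ a b c e, T b a c e = -T a b c e) (hT2 : ∀ a b c e, T a b e c = -T a b c e)
    (hstep : ∀ κ κ' κ₁ κ₂, A κ κ' κ₁ κ₂ + A κ' κ κ₁ κ₂ + (A κ κ' κ₂ κ₁ + A κ' κ κ₂ κ₁)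
      = T κ κ₁ κ' κ₂ + T κ' κ₁ κ κ₂ + (T κ κ₂ κ' κ₁ + T κ' κ₂ κ κ₁) + t * (B κ κ' κ₁ κ₂ + B κ' κ κ₁ κ₂ + (B κ κ' κ₂ κ₁ + B κ' κ κ₂ κ₁)))
    (hB : ∃ S : ι → ι → ι → ι → ℝ, (∀ a b c e, S b a c e = -S a b c e) ∧ (∀ a b c e, S a b e c = -S a b c e) ∧
      ∀ κ κ' κ₁ κ₂, B κ κ' κ₁ κ₂ + B κ' κ κ₁ κ₂ + (B κ κ' κ₂ κ₁ + B κ' κ κ₂ κ₁) = S κ κ₁ κ' κ₂ + S κ' κ₁ κ κ₂ + (S κ κ₂ κ' κ₁ + S κ' κ₂ κ κ₁)) :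
    ∃ R : ι → ι → ι → ι → ℝ, (∀ a b c e, R b a c e = -R a b c e) ∧ (∀ a b c e, R a b e c = -R a b c e) ∧
      ∀ κ κ' κ₁ κ₂, A κ κ' κ₁ κ₂ + A κ' κ κ₁ κ₂ + (A κ κ' κ₂ κ₁ + A κ' κ κ₂ κ₁) = R κ κ₁ κ' κ₂ + R κ' κ₁ κ κ₂ + (R κ κ₂ κ' κ₁ + R κ' κ₂ κ κ₁) := by
  obtain ⟨S, hS1, hS2, hS⟩ := hB
  refine ⟨fun a b c e => T a b c e + t * S a b c e, CombChargeAntisymPairForm.antisym_add_fst hT1 (antisym_smul_fst hS1 t),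
    CombChargeAntisymPairForm.antisym_add_snd hT2 (antisym_smul_snd hS2 t), fun κ κ' κ₁ κ₂ => ?_⟩
  have h1 := hstep κ κ' κ₁ κ₂
  have h2 := hS κ κ' κ₁ κ₂
  have h2' : t * (B κ κ' κ₁ κ₂ + B κ' κ κ₁ κ₂ + (B κ κ' κ₂ κ₁ + B κ' κ κ₂ κ₁))
      = t * (S κ κ₁ κ' κ₂ + S κ' κ₁ κ κ₂ + (S κ κ₂ κ' κ₁ + S κ' κ₂ κ κ₁)) := by rw [h2]
  dsimp only
  linarith

end Algebra

/-! ## §2 The two-index tower: induction on the level with the period generalised -/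

section Tower

variable {ι : Type*}

/-- NOT IN PRINT; OUR BOOKKEEPING.  **THE TWO-INDEX PAIR-FORM TOWER, arbitrary period re-indexing.**  Amplitudes `Z m i` (period index `m`, level `i`): if every base
amplitude `Z m 0` has the antisymmetric-pair form (`h0` — for the comb: the level-`0` Wilson table read on period-`m` face fields) and, at every `(m, i)`, the step display
`LS(Z m (i+1)) = (pair form of some T) + c m i · LS(Z (σ m) i)` holds (`hstep` — the level-`i+1` member's symmetrised charge on period-`m` faces = its own words, each a pair form,
plus a multiple of the level-`i` member read on the re-indexed period `σ m`), then EVERY `Z m i` has the antisymmetric-pair form.  Induction on `i`, all of `m` generalised; the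
period index ranges over an ARBITRARY type `π` (e.g. `ℕ` for `P = Lc^m`, or pairs of slot ∕ leg periods `(N, N′)` as in leaf-06's deep currents), `σ : π → π` any map. -/
theorem pairFormLS_tower₂_reindex {π : Type*} {Z : π → ℕ → ι → ι → ι → ι → ℝ} {c : π → ℕ → ℝ} (σ : π → π)
    (h0 : ∀ m, ∃ R : ι → ι → ι → ι → ℝ, (∀ a b c e, R b a c e = -R a b c e) ∧ (∀ a b c e, R a b e c = -R a b c e) ∧
      ∀ κ κ' κ₁ κ₂, Z m 0 κ κ' κ₁ κ₂ + Z m 0 κ' κ κ₁ κ₂ + (Z m 0 κ κ' κ₂ κ₁ + Z m 0 κ' κ κ₂ κ₁) = R κ κ₁ κ' κ₂ + R κ' κ₁ κ κ₂ + (R κ κ₂ κ' κ₁ + R κ' κ₂ κ κ₁))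
    (hstep : ∀ m i, ∃ T : ι → ι → ι → ι → ℝ, (∀ a b c e, T b a c e = -T a b c e) ∧ (∀ a b c e, T a b e c = -T a b c e) ∧
      ∀ κ κ' κ₁ κ₂, Z m (i + 1) κ κ' κ₁ κ₂ + Z m (i + 1) κ' κ κ₁ κ₂ + (Z m (i + 1) κ κ' κ₂ κ₁ + Z m (i + 1) κ' κ κ₂ κ₁)
        = T κ κ₁ κ' κ₂ + T κ' κ₁ κ κ₂ + (T κ κ₂ κ' κ₁ + T κ' κ₂ κ κ₁)
          + c m i * (Z (σ m) i κ κ' κ₁ κ₂ + Z (σ m) i κ' κ κ₁ κ₂ + (Z (σ m) i κ κ' κ₂ κ₁ + Z (σ m) i κ' κ κ₂ κ₁)))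
    (m : π) (i : ℕ) :
    ∃ R : ι → ι → ι → ι → ℝ, (∀ a b c e, R b a c e = -R a b c e) ∧ (∀ a b c e, R a b e c = -R a b c e) ∧
      ∀ κ κ' κ₁ κ₂, Z m i κ κ' κ₁ κ₂ + Z m i κ' κ κ₁ κ₂ + (Z m i κ κ' κ₂ κ₁ + Z m i κ' κ κ₂ κ₁) = R κ κ₁ κ' κ₂ + R κ' κ₁ κ κ₂ + (R κ κ₂ κ' κ₁ + R κ' κ₂ κ κ₁) := by
  induction i generalizing m with
  | zero => exact h0 m
  | succ n ih =>
    obtain ⟨T, hT1, hT2, hT⟩ := hstep m n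
    exact exists_pairFormLS_of_step hT1 hT2 hT (ih (σ m))

/-- NOT IN PRINT; OUR BOOKKEEPING.  **THE TWO-INDEX PAIR-FORM TOWER** (leaf-02 g68 memo §4's `Φ_m(i+1) = PF^{(m)}_i + c_i·Φ_{m+1}(i)`: one block-averaging step turns period-`Lc^m`
face reads of the level-`i+1` member into period-`Lc^{m+1}` face reads of the level-`i` member): base pair forms at every period + pair-form steps ⟹ every `Z m i` is a pair form;
at the constant-read index (road-P2's `zmode`; `m = 0` in §4's `hZ0` convention) this is road-P2's member-level `hPair` at every level, with the dressing-defect zero modes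
((G14)) INSIDE the induction instead of a side condition. -/
theorem pairFormLS_tower₂ {Z : ℕ → ℕ → ι → ι → ι → ι → ℝ} {c : ℕ → ℕ → ℝ}
    (h0 : ∀ m, ∃ R : ι → ι → ι → ι → ℝ, (∀ a b c e, R b a c e = -R a b c e) ∧ (∀ a b c e, R a b e c = -R a b c e) ∧
      ∀ κ κ' κ₁ κ₂, Z m 0 κ κ' κ₁ κ₂ + Z m 0 κ' κ κ₁ κ₂ + (Z m 0 κ κ' κ₂ κ₁ + Z m 0 κ' κ κ₂ κ₁) = R κ κ₁ κ' κ₂ + R κ' κ₁ κ κ₂ + (R κ κ₂ κ' κ₁ + R κ' κ₂ κ κ₁))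
    (hstep : ∀ m i, ∃ T : ι → ι → ι → ι → ℝ, (∀ a b c e, T b a c e = -T a b c e) ∧ (∀ a b c e, T a b e c = -T a b c e) ∧
      ∀ κ κ' κ₁ κ₂, Z m (i + 1) κ κ' κ₁ κ₂ + Z m (i + 1) κ' κ κ₁ κ₂ + (Z m (i + 1) κ κ' κ₂ κ₁ + Z m (i + 1) κ' κ κ₂ κ₁)
        = T κ κ₁ κ' κ₂ + T κ' κ₁ κ κ₂ + (T κ κ₂ κ' κ₁ + T κ' κ₂ κ κ₁)
          + c m i * (Z (m + 1) i κ κ' κ₁ κ₂ + Z (m + 1) i κ' κ κ₁ κ₂ + (Z (m + 1) i κ κ' κ₂ κ₁ + Z (m + 1) i κ' κ κ₂ κ₁)))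
    (m i : ℕ) :
    ∃ R : ι → ι → ι → ι → ℝ, (∀ a b c e, R b a c e = -R a b c e) ∧ (∀ a b c e, R a b e c = -R a b c e) ∧
      ∀ κ κ' κ₁ κ₂, Z m i κ κ' κ₁ κ₂ + Z m i κ' κ κ₁ κ₂ + (Z m i κ κ' κ₂ κ₁ + Z m i κ' κ κ₂ κ₁) = R κ κ₁ κ' κ₂ + R κ' κ₁ κ κ₂ + (R κ κ₂ κ' κ₁ + R κ' κ₂ κ κ₁) :=
  pairFormLS_tower₂_reindex (fun m => m + 1) h0 hstep m i

/-- NOT IN PRINT; OUR BOOKKEEPING.  **THE SOURCE-TYPE DIFFERENCES OF THE TOWER ARE PAIR FORMS**: under the hypotheses of `pairFormLS_tower₂`, for every `(m, i)` and every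
charge factor `u`, `LS(Z m (i+1) − u·Z m i)` is a pair form — at the constant-read index with `u = 1` (the pins, `T2RecChargeLedger.charge_factor_eq_one_of_pinEq`) this is the shape of road-P2's
`hSrc` once the source's zero mode is displayed as `zmode(member_{l+2}) − zmode(member_{l+1})` (`RowCChargeForms.zmode_pi_sub`). -/
theorem pairFormLS_tower₂_diff {Z : ℕ → ℕ → ι → ι → ι → ι → ℝ} {c : ℕ → ℕ → ℝ}
    (h0 : ∀ m, ∃ R : ι → ι → ι → ι → ℝ, (∀ a b c e, R b a c e = -R a b c e) ∧ (∀ a b c e, R a b e c = -R a b c e) ∧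
      ∀ κ κ' κ₁ κ₂, Z m 0 κ κ' κ₁ κ₂ + Z m 0 κ' κ κ₁ κ₂ + (Z m 0 κ κ' κ₂ κ₁ + Z m 0 κ' κ κ₂ κ₁) = R κ κ₁ κ' κ₂ + R κ' κ₁ κ κ₂ + (R κ κ₂ κ' κ₁ + R κ' κ₂ κ κ₁))
    (hstep : ∀ m i, ∃ T : ι → ι → ι → ι → ℝ, (∀ a b c e, T b a c e = -T a b c e) ∧ (∀ a b c e, T a b e c = -T a b c e) ∧
      ∀ κ κ' κ₁ κ₂, Z m (i + 1) κ κ' κ₁ κ₂ + Z m (i + 1) κ' κ κ₁ κ₂ + (Z m (i + 1) κ κ' κ₂ κ₁ + Z m (i + 1) κ' κ κ₂ κ₁)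
        = T κ κ₁ κ' κ₂ + T κ' κ₁ κ κ₂ + (T κ κ₂ κ' κ₁ + T κ' κ₂ κ κ₁)
          + c m i * (Z (m + 1) i κ κ' κ₁ κ₂ + Z (m + 1) i κ' κ κ₁ κ₂ + (Z (m + 1) i κ κ' κ₂ κ₁ + Z (m + 1) i κ' κ κ₂ κ₁)))
    (u : ℝ) (m i : ℕ) :
    ∃ R : ι → ι → ι → ι → ℝ, (∀ a b c e, R b a c e = -R a b c e) ∧ (∀ a b c e, R a b e c = -R a b c e) ∧
      ∀ κ κ' κ₁ κ₂, (Z m (i + 1) κ κ' κ₁ κ₂ - u * Z m i κ κ' κ₁ κ₂) + (Z m (i + 1) κ' κ κ₁ κ₂ - u * Z m i κ' κ κ₁ κ₂)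
          + ((Z m (i + 1) κ κ' κ₂ κ₁ - u * Z m i κ κ' κ₂ κ₁) + (Z m (i + 1) κ' κ κ₂ κ₁ - u * Z m i κ' κ κ₂ κ₁))
        = R κ κ₁ κ' κ₂ + R κ' κ₁ κ κ₂ + (R κ κ₂ κ' κ₁ + R κ' κ₂ κ κ₁) :=
  exists_pairFormLS_sub (pairFormLS_tower₂ h0 hstep m (i + 1)) (pairFormLS_tower₂ h0 hstep m i) u

end Tower

/-! ## §3 The crossed-value ledger of the two-index tower (scalars only; the located sufficient condition for `hSrcX`, NO value asserted) -/

section Ledger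

/-- NOT IN PRINT; OUR BOOKKEEPING.  **THE CROSSED-VALUE LEDGER, ONE STEP**: the crossed orbit sum `(a,b;a,b)` of a pair-form display is `−2·T(ab;ab)` plus the lower term —
if `LS_A = (pair form of T) + t·LS_B` entry by entry with `T` antisymmetric in each pair, then
`A abab + A baab + (A abba + A baba) = −2·T a b a b + t·(B abab + B baab + (B abba + B baba))` (one scalar per pair, level and period). -/
theorem crossed_of_step {ι : Type*} {A B T : ι → ι → ι → ι → ℝ} {t : ℝ}
    (hT1 : ∀ a b c e, T b a c e = -T a b c e) (hT2 : ∀ a b c e, T a b e c = -T a b c e)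
    (hstep : ∀ κ κ' κ₁ κ₂, A κ κ' κ₁ κ₂ + A κ' κ κ₁ κ₂ + (A κ κ' κ₂ κ₁ + A κ' κ κ₂ κ₁)
      = T κ κ₁ κ' κ₂ + T κ' κ₁ κ κ₂ + (T κ κ₂ κ' κ₁ + T κ' κ₂ κ κ₁) + t * (B κ κ' κ₁ κ₂ + B κ' κ κ₁ κ₂ + (B κ κ' κ₂ κ₁ + B κ' κ κ₂ κ₁)))
    (a b : ι) :
    A a b a b + A b a a b + (A a b b a + A b a b a) = -2 * T a b a b + t * (B a b a b + B b a a b + (B a b b a + B b a b a)) := by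
  have h := hstep a b a b
  have h1 : T a a b b = 0 := CombChargeAntisymPairForm.pair_diag_fst hT1 a b b
  have h2 : T b b a a = 0 := CombChargeAntisymPairForm.pair_diag_fst hT1 b a a
  have h3 : T b a a b = -T a b a b := hT1 a b a b
  have h4 : T a b b a = -T a b a b := hT2 a b a b
  linarith

/-- NOT IN PRINT; OUR BOOKKEEPING.  **THE LEDGER CLOSES UNDER LEVEL-INDEPENDENT WORD VALUES** (the located SUFFICIENT condition for road-P2's `hSrcX` ∕ leaf-02's `hX`, scalars
only, NO value of any table asserted): if the crossed values `X m i` of the two-index tower obey `X m (i+1) = p m + c m · X (m+1) i` with word values `p m` and coefficients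
`c m` that do NOT depend on the level, and the base values `w m := X m 0` satisfy the one identity `p m + c m · w (m+1) = w m` at every period, then `X m i = w m` at EVERY
level — the crossed value is conserved along the tower at every period (`m = 0`: the member's crossed orbit sums are constant in the level, i.e. the source's vanish). -/
theorem crossed_tower₂_const {X : ℕ → ℕ → ℝ} {p c w : ℕ → ℝ}
    (h0 : ∀ m, X m 0 = w m) (hstep : ∀ m i, X m (i + 1) = p m + c m * X (m + 1) i) (hbase : ∀ m, p m + c m * w (m + 1) = w m)
    (m i : ℕ) : X m i = w m := by
  induction i generalizing m with
  | zero => exact h0 m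
  | succ n ih => rw [hstep, ih (m + 1), hbase]

/-- NOT IN PRINT; OUR BOOKKEEPING.  **HENCE THE SOURCE-TYPE DIFFERENCES OF THE LEDGER VANISH**: under the same scalar hypotheses, `X m (i+1) − u·X m i = (1 − u)·w m`; at the
pins' charge factor `u = 1` this is `0` (road-P2's `hSrcX` shape at `m = 0`). -/
theorem crossed_tower₂_diff {X : ℕ → ℕ → ℝ} {p c w : ℕ → ℝ}
    (h0 : ∀ m, X m 0 = w m) (hstep : ∀ m i, X m (i + 1) = p m + c m * X (m + 1) i) (hbase : ∀ m, p m + c m * w (m + 1) = w m)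
    (u : ℝ) (m i : ℕ) : X m (i + 1) - u * X m i = (1 - u) * w m := by
  rw [crossed_tower₂_const h0 hstep hbase m (i + 1), crossed_tower₂_const h0 hstep hbase m i]; ring

/-- NOT IN PRINT; OUR BOOKKEEPING.  **THE GENERAL LEDGER IS GUESS-AND-VERIFY** (level-DEPENDENT word values `p m i` and coefficients `c m i` — the realistic case: leaf-04's
j167436 numbers have the contact and exchange words scaling DIFFERENTLY between levels, only their total scaling by the unit): any candidate closed form `f m i` with the same
base values and the same step recursion IS the crossed value at every `(m, i)` (uniqueness of the two-index recursion; `crossed_tower₂_const` is the case `f m i = w m`).  The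
suppliers' closed forms for `p`, `c`, `w` and their candidate `f` then give `hSrcX` as the scalar identity `f 0 (l+2) = f 0 (l+1)`. -/
theorem crossed_tower₂_eq_of_candidate {X f p c : ℕ → ℕ → ℝ}
    (h0 : ∀ m, X m 0 = f m 0) (hstep : ∀ m i, X m (i + 1) = p m i + c m i * X (m + 1) i) (hf : ∀ m i, f m (i + 1) = p m i + c m i * f (m + 1) i)
    (m i : ℕ) : X m i = f m i := by
  induction i generalizing m with
  | zero => exact h0 m
  | succ n ih => rw [hstep, ih (m + 1), hf]

end Ledger

/-! ## §4 At the capstone's display: `hPair` ∕ `hZeven` from the two-index tower -/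

section Literal

variable {Lc : ℕ} [NeZero Lc] {r : Fin (3 + 1) → ℕ}

/-- NOT IN PRINT; OUR BOOKKEEPING.  **THE JUNCTION AT THE LITERAL** (generic colour constants ∕ tables ∕ root, as in `CombChargeAntisymPairForm` §3): for ANY two-index family
`Z m i` whose period-index-`0` row IS road-P2's member charge (`hZ0 : Z 0 i (κ,κ′;κ₁,κ₂) = zmode Lc (unitS₂_i T̃_i) κ κ′ (inl κ₁) (inl κ₂)` — the rows `m ≥ 1` are the typists'
face-period reads, any convention), base pair forms at every period (`h0`) and the step displays (`hstep`) give `hPair` at every member level `≥ 1` (`pairFormLS_tower₂` at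
`m = 0`), hence — with the crossed conservation `hX` — the even-class row `hZeven` of `WrecAtEvenHalfRowsOfQLCEvenClasses.exists_allScalesSeq_JsRowD1Pin_of_QL_zsymLegSymEvenClasses`
VERBATIM (`CombChargeAntisymPairForm.zsymLegSymEven_of_pairFormLS_crossed`).  One `obtain` + four rewrites; nothing valued. -/
theorem zsymLegSymEven_of_tower₂_crossed (cE cVH cΛ cE₂ cB : ℝ) (Tc : Fin 4 → Fin 4 → Fin 4 → Fin 4 → ℝ)
    (vh₂S : Fin (3 + 1) → (Fin (3 + 1) → ℤ) → Fin (3 + 1) → (Fin (3 + 1) → ℤ) → MKer (3 + 1) (Fib 3))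
    {Z : ℕ → ℕ → Fin (3 + 1) → Fin (3 + 1) → Fin (3 + 1) → Fin (3 + 1) → ℝ} {c : ℕ → ℕ → ℝ}
    (hZ0 : ∀ (i : ℕ) (κ κ' κ₁ κ₂ : Fin (3 + 1)), Z 0 i κ κ' κ₁ κ₂
      = zmode Lc (unitS₂ (sfStep Lc i) (smStep 3 Lc i) (T2RecAt 3 Lc (toSite r) cE cVH cΛ cE₂ cB Tc vh₂S (mixFFAt (toSite r) Lc) i)) κ κ' (Sum.inl κ₁) (Sum.inl κ₂))
    (h0 : ∀ m, ∃ R : Fin (3 + 1) → Fin (3 + 1) → Fin (3 + 1) → Fin (3 + 1) → ℝ,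
      (∀ a b c e, R b a c e = -R a b c e) ∧ (∀ a b c e, R a b e c = -R a b c e) ∧
      ∀ κ κ' κ₁ κ₂, Z m 0 κ κ' κ₁ κ₂ + Z m 0 κ' κ κ₁ κ₂ + (Z m 0 κ κ' κ₂ κ₁ + Z m 0 κ' κ κ₂ κ₁) = R κ κ₁ κ' κ₂ + R κ' κ₁ κ κ₂ + (R κ κ₂ κ' κ₁ + R κ' κ₂ κ κ₁))
    (hstep : ∀ m i, ∃ T : Fin (3 + 1) → Fin (3 + 1) → Fin (3 + 1) → Fin (3 + 1) → ℝ,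
      (∀ a b c e, T b a c e = -T a b c e) ∧ (∀ a b c e, T a b e c = -T a b c e) ∧
      ∀ κ κ' κ₁ κ₂, Z m (i + 1) κ κ' κ₁ κ₂ + Z m (i + 1) κ' κ κ₁ κ₂ + (Z m (i + 1) κ κ' κ₂ κ₁ + Z m (i + 1) κ' κ κ₂ κ₁)
        = T κ κ₁ κ' κ₂ + T κ' κ₁ κ κ₂ + (T κ κ₂ κ' κ₁ + T κ' κ₂ κ κ₁)
          + c m i * (Z (m + 1) i κ κ' κ₁ κ₂ + Z (m + 1) i κ' κ κ₁ κ₂ + (Z (m + 1) i κ κ' κ₂ κ₁ + Z (m + 1) i κ' κ κ₂ κ₁)))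
    (hX : ∀ (l : ℕ) (a b : Fin (3 + 1)), a ≠ b →
      zmode Lc (unitS₂ (sfStep Lc (l + 1 + 1)) (smStep 3 Lc (l + 1 + 1)) (T2RecAt 3 Lc (toSite r) cE cVH cΛ cE₂ cB Tc vh₂S (mixFFAt (toSite r) Lc) (l + 1 + 1))) a b (Sum.inl a) (Sum.inl b) + zmode Lc (unitS₂ (sfStep Lc (l + 1 + 1)) (smStep 3 Lc (l + 1 + 1)) (T2RecAt 3 Lc (toSite r) cE cVH cΛ cE₂ cB Tc vh₂S (mixFFAt (toSite r) Lc) (l + 1 + 1))) b a (Sum.inl a) (Sum.inl b) + (zmode Lc (unitS₂ (sfStep Lc (l + 1 + 1)) (smStep 3 Lc (l + 1 + 1)) (T2RecAt 3 Lc (toSite r) cE cVH cΛ cE₂ cB Tc vh₂S (mixFFAt (toSite r) Lc) (l + 1 + 1))) a b (Sum.inl b) (Sum.inl a) + zmode Lc (unitS₂ (sfStep Lc (l + 1 + 1)) (smStep 3 Lc (l + 1 + 1)) (T2RecAt 3 Lc (toSite r) cE cVH cΛ cE₂ cB Tc vh₂S (mixFFAt (toSite r) Lc) (l + 1 + 1)))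 b a (Sum.inl b) (Sum.inl a))
      = zmode Lc (unitS₂ (sfStep Lc (l + 1)) (smStep 3 Lc (l + 1)) (T2RecAt 3 Lc (toSite r) cE cVH cΛ cE₂ cB Tc vh₂S (mixFFAt (toSite r) Lc) (l + 1))) a b (Sum.inl a) (Sum.inl b) + zmode Lc (unitS₂ (sfStep Lc (l + 1)) (smStep 3 Lc (l + 1)) (T2RecAt 3 Lc (toSite r) cE cVH cΛ cE₂ cB Tc vh₂S (mixFFAt (toSite r) Lc) (l + 1))) b a (Sum.inl a) (Sum.inl b) + (zmode Lc (unitS₂ (sfStep Lc (l + 1)) (smStep 3 Lc (l + 1)) (T2RecAt 3 Lc (toSite r) cE cVH cΛ cE₂ cB Tc vh₂S (mixFFAt (toSite r) Lc) (l + 1))) a b (Sum.inl b) (Sum.inl a) + zmode Lc (unitS₂ (sfStep Lc (l + 1)) (smStep 3 Lc (l + 1)) (T2RecAt 3 Lc (toSite r) cE cVH cΛ cE₂ cB Tc vh₂S (mixFFAt (toSite r) Lc) (l + 1))) b a (Sum.inl b) (Sum.inl a)))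
    (l : ℕ) (κ κ' κ₁ κ₂ : Fin (3 + 1)) (heven : ¬ ∃ α : Fin 4, reflSign α κ * reflSign α κ' * reflSign α κ₁ * reflSign α κ₂ = -1) :
    zmode Lc (unitS₂ (sfStep Lc (l + 1 + 1)) (smStep 3 Lc (l + 1 + 1)) (T2RecAt 3 Lc (toSite r) cE cVH cΛ cE₂ cB Tc vh₂S (mixFFAt (toSite r) Lc) (l + 1 + 1))) κ κ' (Sum.inl κ₁) (Sum.inl κ₂)
        + zmode Lc (unitS₂ (sfStep Lc (l + 1 + 1)) (smStep 3 Lc (l + 1 + 1)) (T2RecAt 3 Lc (toSite r) cE cVH cΛ cE₂ cB Tc vh₂S (mixFFAt (toSite r) Lc) (l + 1 + 1))) κ' κ (Sum.inl κ₁) (Sum.inl κ₂)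
        + (zmode Lc (unitS₂ (sfStep Lc (l + 1 + 1)) (smStep 3 Lc (l + 1 + 1)) (T2RecAt 3 Lc (toSite r) cE cVH cΛ cE₂ cB Tc vh₂S (mixFFAt (toSite r) Lc) (l + 1 + 1))) κ κ' (Sum.inl κ₂) (Sum.inl κ₁)
        + zmode Lc (unitS₂ (sfStep Lc (l + 1 + 1)) (smStep 3 Lc (l + 1 + 1)) (T2RecAt 3 Lc (toSite r) cE cVH cΛ cE₂ cB Tc vh₂S (mixFFAt (toSite r) Lc) (l + 1 + 1))) κ' κ (Sum.inl κ₂) (Sum.inl κ₁))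
      = zmode Lc (unitS₂ (sfStep Lc (l + 1)) (smStep 3 Lc (l + 1)) (T2RecAt 3 Lc (toSite r) cE cVH cΛ cE₂ cB Tc vh₂S (mixFFAt (toSite r) Lc) (l + 1))) κ κ' (Sum.inl κ₁) (Sum.inl κ₂)
        + zmode Lc (unitS₂ (sfStep Lc (l + 1)) (smStep 3 Lc (l + 1)) (T2RecAt 3 Lc (toSite r) cE cVH cΛ cE₂ cB Tc vh₂S (mixFFAt (toSite r) Lc) (l + 1))) κ' κ (Sum.inl κ₁) (Sum.inl κ₂)
        + (zmode Lc (unitS₂ (sfStep Lc (l + 1)) (smStep 3 Lc (l + 1)) (T2RecAt 3 Lc (toSite r) cE cVH cΛ cE₂ cB Tc vh₂S (mixFFAt (toSite r) Lc) (l + 1))) κ κ' (Sum.inl κ₂) (Sum.inl κ₁)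
        + zmode Lc (unitS₂ (sfStep Lc (l + 1)) (smStep 3 Lc (l + 1)) (T2RecAt 3 Lc (toSite r) cE cVH cΛ cE₂ cB Tc vh₂S (mixFFAt (toSite r) Lc) (l + 1))) κ' κ (Sum.inl κ₂) (Sum.inl κ₁)) := by
  refine CombChargeAntisymPairForm.zsymLegSymEven_of_pairFormLS_crossed cE cVH cΛ cE₂ cB Tc vh₂S (fun m => ?_) hX l κ κ' κ₁ κ₂ heven
  obtain ⟨R, hR1, hR2, hR⟩ := pairFormLS_tower₂ h0 hstep 0 (m + 1)
  refine ⟨R, hR1, hR2, fun μ ν α β => ?_⟩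
  rw [← hZ0 (m + 1) μ ν α β, ← hZ0 (m + 1) ν μ α β, ← hZ0 (m + 1) μ ν β α, ← hZ0 (m + 1) ν μ β α]
  exact hR μ ν α β

end Literal

/-! ## §5 The multi-term step: a display with SEVERAL lower-period terms (the list-valued variant) -/

section Multi

variable {ι : Type*}

/-- NOT IN PRINT; OUR BOOKKEEPING.  **FINITE SUMS**: if every `LS_{B k}`, `k ∈ s`, is a pair form then so is `LS` of the weighted sum `Σ_{k ∈ s} t k · B k` (induction on the
finite set; witnesses add). -/
theorem exists_pairFormLS_finsum {α : Type*} [DecidableEq α] (s : Finset α) {B : α → ι → ι → ι → ι → ℝ} (t : α → ℝ)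
    (hB : ∀ k ∈ s, ∃ S : ι → ι → ι → ι → ℝ, (∀ a b c e, S b a c e = -S a b c e) ∧ (∀ a b c e, S a b e c = -S a b c e) ∧
      ∀ κ κ' κ₁ κ₂, B k κ κ' κ₁ κ₂ + B k κ' κ κ₁ κ₂ + (B k κ κ' κ₂ κ₁ + B k κ' κ κ₂ κ₁) = S κ κ₁ κ' κ₂ + S κ' κ₁ κ κ₂ + (S κ κ₂ κ' κ₁ + S κ' κ₂ κ κ₁)) :
    ∃ R : ι → ι → ι → ι → ℝ, (∀ a b c e, R b a c e = -R a b c e) ∧ (∀ a b c e, R a b e c = -R a b c e) ∧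
      ∀ κ κ' κ₁ κ₂, (∑ k ∈ s, t k * B k κ κ' κ₁ κ₂) + (∑ k ∈ s, t k * B k κ' κ κ₁ κ₂)
          + ((∑ k ∈ s, t k * B k κ κ' κ₂ κ₁) + (∑ k ∈ s, t k * B k κ' κ κ₂ κ₁))
        = R κ κ₁ κ' κ₂ + R κ' κ₁ κ κ₂ + (R κ κ₂ κ' κ₁ + R κ' κ₂ κ κ₁) := by
  induction s using Finset.induction_on with
  | empty => exact ⟨fun _ _ _ _ => 0, fun _ _ _ _ => by simp, fun _ _ _ _ => by simp, fun κ κ' κ₁ κ₂ => by simp⟩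
  | insert k s hk ih =>
    obtain ⟨R, hR1, hR2, hR⟩ := ih (fun k' hk' => hB k' (Finset.mem_insert_of_mem hk'))
    obtain ⟨S, hS1, hS2, hS⟩ := hB k (Finset.mem_insert_self k s)
    refine ⟨fun a b c e => t k * S a b c e + R a b c e, CombChargeAntisymPairForm.antisym_add_fst (antisym_smul_fst hS1 (t k)) hR1,
      CombChargeAntisymPairForm.antisym_add_snd (antisym_smul_snd hS2 (t k)) hR2, fun κ κ' κ₁ κ₂ => ?_⟩
    have h1 := hR κ κ' κ₁ κ₂
    have h2 := hS κ κ' κ₁ κ₂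
    have h2' : t k * (B k κ κ' κ₁ κ₂ + B k κ' κ κ₁ κ₂ + (B k κ κ' κ₂ κ₁ + B k κ' κ κ₂ κ₁))
        = t k * (S κ κ₁ κ' κ₂ + S κ' κ₁ κ κ₂ + (S κ κ₂ κ' κ₁ + S κ' κ₂ κ κ₁)) := by rw [h2]
    simp only [Finset.sum_insert hk]
    linarith

/-- NOT IN PRINT; OUR BOOKKEEPING.  **THE TWO-INDEX TOWER WITH A MULTI-TERM STEP** (the list-valued variant of `pairFormLS_tower₂_reindex`): period index in an arbitrary
type `π`; at every `(m, i)` the step display may carry FINITELY MANY lower-level terms, `LS(Z m (i+1)) = (pair form) + Σ_{k ∈ s} c m i k · LS(Z (σ m k) i)` (a step whose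
words read the level-`i` member on several deeper periods at once — e.g. mixed slot ∕ leg periods); base pair forms at every period index ⟹ every `Z m i` is a pair form. -/
theorem pairFormLS_tower₂_multi {π α : Type*} [DecidableEq α] (s : Finset α) {Z : π → ℕ → ι → ι → ι → ι → ℝ} {c : π → ℕ → α → ℝ} (σ : π → α → π)
    (h0 : ∀ m, ∃ R : ι → ι → ι → ι → ℝ, (∀ a b c e, R b a c e = -R a b c e) ∧ (∀ a b c e, R a b e c = -R a b c e) ∧
      ∀ κ κ' κ₁ κ₂, Z m 0 κ κ' κ₁ κ₂ + Z m 0 κ' κ κ₁ κ₂ + (Z m 0 κ κ' κ₂ κ₁ + Z m 0 κ' κ κ₂ κ₁) = R κ κ₁ κ' κ₂ + R κ' κ₁ κ κ₂ + (R κ κ₂ κ' κ₁ + R κ' κ₂ κ κ₁))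
    (hstep : ∀ m i, ∃ T : ι → ι → ι → ι → ℝ, (∀ a b c e, T b a c e = -T a b c e) ∧ (∀ a b c e, T a b e c = -T a b c e) ∧
      ∀ κ κ' κ₁ κ₂, Z m (i + 1) κ κ' κ₁ κ₂ + Z m (i + 1) κ' κ κ₁ κ₂ + (Z m (i + 1) κ κ' κ₂ κ₁ + Z m (i + 1) κ' κ κ₂ κ₁)
        = T κ κ₁ κ' κ₂ + T κ' κ₁ κ κ₂ + (T κ κ₂ κ' κ₁ + T κ' κ₂ κ κ₁)
          + ((∑ k ∈ s, c m i k * Z (σ m k) i κ κ' κ₁ κ₂) + (∑ k ∈ s, c m i k * Z (σ m k) i κ' κ κ₁ κ₂)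
            + ((∑ k ∈ s, c m i k * Z (σ m k) i κ κ' κ₂ κ₁) + (∑ k ∈ s, c m i k * Z (σ m k) i κ' κ κ₂ κ₁))))
    (m : π) (i : ℕ) :
    ∃ R : ι → ι → ι → ι → ℝ, (∀ a b c e, R b a c e = -R a b c e) ∧ (∀ a b c e, R a b e c = -R a b c e) ∧
      ∀ κ κ' κ₁ κ₂, Z m i κ κ' κ₁ κ₂ + Z m i κ' κ κ₁ κ₂ + (Z m i κ κ' κ₂ κ₁ + Z m i κ' κ κ₂ κ₁) = R κ κ₁ κ' κ₂ + R κ' κ₁ κ κ₂ + (R κ κ₂ κ' κ₁ + R κ' κ₂ κ κ₁) := by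
  induction i generalizing m with
  | zero => exact h0 m
  | succ n ih =>
    obtain ⟨T, hT1, hT2, hT⟩ := hstep m n
    obtain ⟨L, hL1, hL2, hL⟩ := exists_pairFormLS_finsum s (c m n) (B := fun k => Z (σ m k) n) (fun k _ => ih (σ m k))
    refine ⟨fun a b c e => T a b c e + L a b c e, CombChargeAntisymPairForm.antisym_add_fst hT1 hL1,
      CombChargeAntisymPairForm.antisym_add_snd hT2 hL2, fun κ κ' κ₁ κ₂ => ?_⟩
    have h1 := hT κ κ' κ₁ κ₂
    have h2 := hL κ κ' κ₁ κ₂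
    dsimp only at h2 ⊢
    linarith

end Multi

end Summit.QuantumFields.BalabanUV.Beta.GAN24.PairFormPeriodTower
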